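import Literature.AnabelianGeometry.EtaleTheta.SettingModelChiCuspDef19Points
import Literature.AnabelianGeometry.EtaleTheta.SettingModelChiMuTwoCusp
import Literature.AnabelianGeometry.EtaleTheta.Discharge.Sec2HasMuLModelChiCuspIff
import HarnessLib

/-!
# The cusped χ-model `χ′`: DEF. 1.9's ANCHORED STANDARD DATUM at `MuTwoSetting.inversionModelχ′` / `MuTwoSetting.modelχ′`
# (`√−1 ∈ K = ℚ_p`, `τ^{±1}` with `Ü(τ^{±1}) = (√−1)^{±1}`), and the R312 census WITH the Def. 1.9 pair (class (b): two definitions)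

S. Mochizuki, *The étale theta function and its Frobenioid-theoretic manifestations*, Publ. RIMS **45** (2009) [EtTh], §1
Def. 1.9 p. 29 («`√−1` determines a 4-torsion point `τ` … the 4-torsion point `τ⁻¹` determined by `−√−1`»), Prop. 1.4 (iii) p. 22;
§2 Def. 2.7 p. 41, Rmk. 2.6.1 p. 40 [cite: MochizukiEtTh2009, Def 1.9 p.29]. Cell abc-iut, layer L2, seat abc-iut-L2-t10 (gen 7),
abc-iut-L2-lead row R530 «Def 1.9 anchored data @χ′» (offered R645). CLASS (b) CONSTRUCTION file over FROZEN interfaces: TWO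
definitions (`anchoredStandardDataχ'Sec`, `anchoredStandardDataModelχ'Sec`) on abc-iut-L2-t6's `MuTwoSetting.AnchoredStandardData`
via its constructor `anchoredStandardDataOfPoints`; no new structure, no instance, no `Prop` fact, no interface clause touched. It is
abc-iut-w5-d140's `anchoredStandardDataχSec` (`Discharge/Sec1Thm110ModelChiNV`, over the cusp-free `MuTwoSetting.modelχ`) RE-TYPED over
the Kummer-carrying CUSPED models, with abc-iut-w5-d118's Def. 1.9 pair `tauχ′` / `tauInvχ′` (`SettingModelChiCuspDef19Points`, p456398)
as the anchored points: the carriers `K`, `K̈`, `Π^tp_X`, `Π^tp_Ÿ`, `Δ_Θ`, `toTheta` of `modelχ′` are those of `modelχ` (`rfl`).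

* **`anchoredStandardDataχ'Sec hp : (MuTwoSetting.inversionModelχ′ p).AnchoredStandardData (kummerDataχ′Sec p)`** (`p ≡ 1 (mod 4)`):
  `√−1 := sqrtNegOneχ` (∈ `K = ℚ_p`), `τ := tauχ′`, `τ⁻¹ := tauInvχ′`; field identities (`rfl`);
* `anchoredStandardDataModelχ'Sec hp` — the same datum read on abc-iut-w5-d029's `MuTwoSetting.modelχ′` (same `toThetaSetting`);
* `anchoredStandardDataχ'Sec_doubleUnderline` — the datum read over the Kummer datum of abc-iut-L2-t10's `doubleUnderlineχ′Sec`
  (`((kummerDataχ′Sec p).etaleThetaDataOfClass (etaDdχ p)).toKummerData = kummerDataχ′Sec p` by `rfl`);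
* **`exists_anchored_orbitEmbedding_hasMuL_rmk261_inversionModelχ'`** — THE R312 CENSUS WITH DEF. 1.9 DATA: for `p ≡ 1 (mod 4)` and odd
  `l ∣ p − 1`: an anchored standard datum `S`, THE cover of record `T` on `Π^tp_C(inversionModelχ′)`, an `OrbitEmbedding` of
  `doubleUnderlineχ′Sec` INTO `T` whose points ARE `S.τ^{±1}`, with `T.HasMuL` (abc-iut-L2-t10 g7's `hasMuL_coverOfRecordχ'`, p466422)
  and Rmk. 2.6.1's four `Aut_K` groups; and `hasMuL_iff_of_anchored` — for THAT cover `HasMuL ↔ l ∣ p − 1` (p467907).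

HONEST FRAMING: SEMI-SYNTHETIC model (χ-twisted root, synthetic toral cusp, SECTION mod-`l` cusp datum; not the tempered `π₁` of an
orbicurve) — consistency / non-vacuity evidence for OUR typed interface ONLY; `p ≡ 1 (mod 4)` is exactly «`√−1 ∈ K`» for `K = ℚ_p`;
nothing of [EtTh] is asserted; typed ≠ proved; instantiated ≠ endorsed; no side is taken on [IUTchIII] Cor. 3.12.
-/

noncomputable section

namespace Literature.AnabelianGeometry.EtaleTheta.SettingModel

open Literature.AnabelianGeometry.SemiGraphs ThetaCovers ThetaSetting
open _root_.Topology _root_.Function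

variable (p : ℕ) [Fact p.Prime]

/-! ### Def. 1.9's anchored standard datum at the cusped inversion model `χ′` -/

/-- **Def. 1.9's anchored standard datum at `MuTwoSetting.inversionModelχ′`** (`p ≡ 1 (mod 4)`): `√−1 ∈ K = ℚ_p`
(abc-iut-w5-d140's `sqrtNegOneχ`), `τ := tauχ′`, `τ⁻¹ := tauInvχ′` (abc-iut-w5-d118), over the section Kummer datum `kummerDataχ′Sec`
(abc-iut-L2-t6's constructor `anchoredStandardDataOfPoints`). DEFINED. [cite: MochizukiEtTh2009, Def 1.9 p.29] -/
def anchoredStandardDataχ'Sec (hp : p % 4 = 1) : (MuTwoSetting.inversionModelχ' p).AnchoredStandardData (kummerDataχ'Sec p) :=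
  MuTwoSetting.anchoredStandardDataOfPoints (sqrtNegOneχ p hp) (sqrtNegOneχ_mem_K p hp) (sqrtNegOneχ_sq p hp)
    (tauχ' p hp) (tauInvχ' p hp) rfl rfl

/-- [cite: MochizukiEtTh2009, Def 1.9 p.29] -/
@[simp] theorem anchoredStandardDataχ'Sec_tau (hp : p % 4 = 1) : (anchoredStandardDataχ'Sec p hp).tau = tauχ' p hp := rfl

/-- [cite: MochizukiEtTh2009, Def 1.9 p.29] -/
@[simp] theorem anchoredStandardDataχ'Sec_tauInv (hp : p % 4 = 1) :
    (anchoredStandardDataχ'Sec p hp).tauInv = tauInvχ' p hp := rfl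

/-- [cite: MochizukiEtTh2009, Def 1.9 p.29] -/
@[simp] theorem anchoredStandardDataχ'Sec_sqrtNegOne (hp : p % 4 = 1) :
    (anchoredStandardDataχ'Sec p hp).sqrtNegOne = sqrtNegOneχ p hp := rfl

/-- `D_τ = s_{√−1}(G_K̈)` for the datum's `τ`. [cite: MochizukiEtTh2009, Def 1.9 p.29] -/
theorem anchoredStandardDataχ'Sec_tau_Dpt (hp : p % 4 = 1) :
    (anchoredStandardDataχ'Sec p hp).tau.Dpt =
      (ThetaSetting.modelχ p).GKdd.map (sectionOfUnitχ p (sqrtNegOneUnitχ p hp)) := rfl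

/-- `D_{τ⁻¹} = s_{(√−1)⁻¹}(G_K̈)` for the datum's `τ⁻¹` (abc-iut-w5-d118's `Dpt_tauInvχ'_eq_map_inv`).
[cite: MochizukiEtTh2009, Def 1.9 p.29] -/
theorem anchoredStandardDataχ'Sec_tauInv_Dpt (hp : p % 4 = 1) :
    (anchoredStandardDataχ'Sec p hp).tauInv.Dpt =
      (ThetaSetting.modelχ p).GKdd.map (sectionOfUnitχ p (sqrtNegOneUnitχ p hp)⁻¹) :=
  Dpt_tauInvχ'_eq_map_inv p hp

/-- Forgetting the anchoring gives Def. 1.9 standard data whose points are `τ^{±1}` as non-cuspidal points.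
[cite: MochizukiEtTh2009, Def 1.9 p.29] -/
theorem anchoredStandardDataχ'Sec_toStandardData_tau (hp : p % 4 = 1) :
    (anchoredStandardDataχ'Sec p hp).toStandardData.tau = (tauχ' p hp).toNonCuspidalPoint ∧
      (anchoredStandardDataχ'Sec p hp).toStandardData.tauInv = (tauInvχ' p hp).toNonCuspidalPoint :=
  ⟨rfl, rfl⟩

/-- **The same datum on abc-iut-w5-d029's cusped `MuTwoSetting.modelχ′`** (F8c; `toThetaSetting = ThetaSetting.modelχ′ p` as for
`inversionModelχ′`, so the `AnchoredStandardData` types agree up to the `MuTwoSetting` carrying them). DEFINED.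
[cite: MochizukiEtTh2009, Def 1.9 p.29] -/
def anchoredStandardDataModelχ'Sec (hp : p % 4 = 1) : (MuTwoSetting.modelχ' p).AnchoredStandardData (kummerDataχ'Sec p) :=
  MuTwoSetting.anchoredStandardDataOfPoints (sqrtNegOneχ p hp) (sqrtNegOneχ_mem_K p hp) (sqrtNegOneχ_sq p hp)
    (tauχ' p hp) (tauInvχ' p hp) rfl rfl

/-- [cite: MochizukiEtTh2009, Def 1.9 p.29] -/
@[simp] theorem anchoredStandardDataModelχ'Sec_tau (hp : p % 4 = 1) :
    (anchoredStandardDataModelχ'Sec p hp).tau = tauχ' p hp := rfl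

/-- [cite: MochizukiEtTh2009, Def 1.9 p.29] -/
@[simp] theorem anchoredStandardDataModelχ'Sec_tauInv (hp : p % 4 = 1) :
    (anchoredStandardDataModelχ'Sec p hp).tauInv = tauInvχ' p hp := rfl

/-- **The datum read over the Kummer datum of `doubleUnderlineχ′Sec`'s étale-theta datum** (the datum carrying the model's own class
`η̈^Θ = etaDdχ`): its `toKummerData` IS `kummerDataχ′Sec p` (`rfl`), so no transport is needed — recorded as an equation of types'
inhabitants for consumers that quantify over `E.toKummerData`. [cite: MochizukiEtTh2009, Def 1.9 p.29] -/
theorem anchoredStandardDataχ'Sec_doubleUnderline (hp : p % 4 = 1) :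
    ∃ S : (MuTwoSetting.inversionModelχ' p).AnchoredStandardData
        ((kummerDataχ'Sec p).etaleThetaDataOfClass (etaDdχ p)).toKummerData,
      S = anchoredStandardDataχ'Sec p hp ∧ S.tau.toNonCuspidalPoint = (tauχ' p hp).toNonCuspidalPoint ∧
        S.tauInv.toNonCuspidalPoint = (tauInvχ' p hp).toNonCuspidalPoint :=
  ⟨anchoredStandardDataχ'Sec p hp, rfl, rfl, rfl⟩

/-! ### THE R312 census at `χ′` WITH the Def. 1.9 pair -/

/-- **THE R312 CENSUS AT `χ′` WITH DEF. 1.9 DATA.** For `p ≡ 1 (mod 4)` and odd `l ∣ p − 1`: the anchored standard datum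
`S := anchoredStandardDataχ′Sec`, THE cover of record `T` on `Π^tp_C(inversionModelχ′)` (abc-iut-L2-d3's `temperedCoverDataOfHuuOfSection`
over THE completion, the Galois section, `g := ε_±`), an `OrbitEmbedding` of abc-iut-L2-t10's `doubleUnderlineχ′Sec` (`Π^tp_{X̲̲} = Huuχ p l`,
class `η̈^Θ = etaDdχ ≠ 1`) into `T` whose points ARE `S.τ^{±1}`, with **`T.HasMuL`** (p466422) and **Rmk. 2.6.1's four `Aut_K` groups**
(`temperedCoverDataOfHuuOfSection_rmk261`). [cite: MochizukiEtTh2009, Def 2.7 p.41] -/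
theorem exists_anchored_orbitEmbedding_hasMuL_rmk261_inversionModelχ' (hp : p % 4 = 1) (l : ℕ+) (hodd : Odd (l : ℕ))
    (hl : (l : ℕ) ∣ p - 1) :
    ∃ (S : (MuTwoSetting.inversionModelχ' p).AnchoredStandardData (kummerDataχ'Sec p)) (T : TemperedCoverData.{0} l)
      (ε : (doubleUnderlineχ'Sec p l hodd).OrbitEmbedding T),
      S = anchoredStandardDataχ'Sec p hp ∧ T.Gtp = (MuTwoSetting.inversionModelχ' p).GtpC ∧
        ε.tau = S.tau.toNonCuspidalPoint ∧ ε.tauInv = S.tauInv.toNonCuspidalPoint ∧ T.HasMuL ∧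
        (Nonempty (T.autK (T.tp T.PiXuu) ≃* Multiplicative (ZMod l) × Multiplicative (ZMod 2)) ∧
          Nonempty (T.autK (T.tp T.PiXu) ≃* DihedralGroup l) ∧
          Nonempty (T.autK (T.tp T.PiCuu) ≃* Multiplicative (ZMod l)) ∧
          Subsingleton (T.autK (T.tp T.PiCu))) := by
  obtain ⟨eX⟩ := nonempty_oncePuncturedData_modelχ' p
  have hK : (MuTwoSetting.inversionModelχ' p).barKerTp l ≤ (doubleUnderlineχ'Sec p l hodd).Huu :=
    barKerTp_le_Huuχ_inversionModelχ' p l hodd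
  have hsH : ∀ σ, sectionχ' p σ ∈ (doubleUnderlineχ'Sec p l hodd).Huu := fun σ => inr_mem_Huuχ p l σ
  have hMuL := hasMuL_coverOfRecordχ' p hodd hl (doubleUnderlineχ'Sec p l hodd) eX hK hsH
    (iotaStable_conjX_epsPMInvχ' p _ rfl)
  refine ⟨anchoredStandardDataχ'Sec p hp, _,
    (cLevelDataInvχ' p).orbitEmbeddingOfHuuOfSection _ _ _ eX hodd _ _ _ _ _ _ _ hK hsH _ _
      (tauχ' p hp).toNonCuspidalPoint (tauInvχ' p hp).toNonCuspidalPoint,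
    rfl, rfl, rfl, rfl, hMuL, ?_⟩
  exact (cLevelDataInvχ' p).temperedCoverDataOfHuuOfSection_rmk261 _ _ _ eX hodd _ _ _ _ _ _ _ hK hsH _ _ hMuL

/-- **For THAT cover, `HasMuL ↔ l ∣ p − 1`** (abc-iut-L2-t10 g7's `hasMuL_coverOfRecordχ'_iff`, p467907): at `p ≡ 1 (mod 4)` the Def. 1.9
datum exists for EVERY odd `l`, but print's «`K ⊇ μ_l`» still decides `HasMuL`. [cite: MochizukiEtTh2009, Rmk 2.6.1 p.40] -/
theorem hasMuL_iff_of_anchored (l : ℕ+) (hodd : Odd (l : ℕ)) (eX : (ThetaSetting.modelχ' p).OncePuncturedData) :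
    ((cLevelDataInvχ' p).temperedCoverDataOfHuuOfSection (cLevelDataInvχ' p).toPiCHat
      (cLevelDataInvχ' p).isProfiniteCompletion_toPiCHat (cLevelDataInvχ' p).toPiCHat_injective eX hodd (sectionχ' p)
      (aug_sectionχ' p) (toZ_sectionχ' p) (inv_ell_piCData_inversionModelχ' p l eX)
      ((cLevelDataInvχ' p).map_inclX_GtpXu_normal l (kerToZIsCompactlyGenerated_modelχ' p))
      ((cLevelDataInvχ' p).map_inclX_GtpY_normal (kerToZIsCompactlyGenerated_modelχ' p)) (doubleUnderlineχ'Sec p l hodd)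
      (barKerTp_le_Huuχ_inversionModelχ' p l hodd) (fun σ => inr_mem_Huuχ p l σ)
      (epsPMInvχ_not_mem_range p) (iotaStable_conjX_epsPMInvχ' p _ rfl)).HasMuL ↔ (l : ℕ) ∣ p - 1 :=
  hasMuL_coverOfRecordχ'_iff p hodd _ eX _ _ _

end Literature.AnabelianGeometry.EtaleTheta.SettingModel

end
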